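import Literature.Computability.MetaComplexity.EFLayout
import Literature.Computability.MetaComplexity.EFSub
import HarnessLib

/-!
# Semantics of the arithmetic netlists: wire values of embedded templates, words, the adder and the comparator

The `EF`-proof construction kit manipulates netlists syntactically; to show that the constraint
sets of the final tautologies are *satisfiable* on the intended inputs one also needs what the
netlists compute. This file provides:

* `Netlist.wireVal_embed`, `Netlist.wireVal_layout` — compositionality of the wire-value
  semantics `Netlist.wireVal` (`EFNetlist.lean`) under embedding and layouts (`EFLayout.lean`):
  the wires of an embedded piece are the wires of the piece on the values it reads;
* `Netlist.wval` — the number carried by the low `W` bits of a word, with its basic arithmetic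
  (bound, congruence, injectivity, parity, reading the bits of a number);
* `Adder.wireVal_addT` — **the ripple-carry adder adds**: sum bits and carry-out together carry
  `x + y + c₀`;
* `Sub.wireVal_subT_ge`, `Sub.wireVal_subT_d` — **the comparator compares**: the carry-out of
  `x + ¬y + 1` is `[x ≥ y]`, and the difference bits carry `x - y` when `x ≥ y`.

## Sources

* H. Vollmer, *Introduction to Circuit Complexity* (Springer 1999), §1.1 (addition and
  subtraction circuits and their correctness), Def. 1.7 (semantics of circuits).
-/

namespace Literature.Computability.MetaComplexity

open _root_.Computability Complexity Complexity.PropForm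

namespace Netlist

/-! ### Wire values of embedded templates -/

/-- Argument values of a remapped argument list. [folklore] -/
theorem argVal_map_remap (inp V : ℕ → Bool) (w : ℕ → ℕ ⊕ ℕ) (off : ℕ) (args : List (ℕ ⊕ ℕ)) (i : ℕ) :
    argVal inp V (args.map (remap w off)) i = argVal (fun i => refVal inp V (w i)) (fun j => V (off + j)) args i := by
  unfold argVal
  rw [List.getElem?_map]
  cases args[i]? with
  | none => rfl
  | some a => cases a <;> rfl

/-- **Wire values of an embedded template.** If the well-formed template `t` contains the
well-formed template `T` embedded at offset `off` through the wiring `w`, then the wires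
`off + k` of `t` carry the wire values of `T` on the values read through `w`.
[cite: Vollmer1999, Def. 1.7] -/
theorem wireVal_embed {t T : Template} {nIn m off : ℕ} {w : ℕ → ℕ ⊕ ℕ} (hwf : t.WF nIn) (hwfT : T.WF m)
    (ht : ∀ (k : ℕ) (hk : k < T.length), ∃ hk' : off + k < t.length, t[off + k] = ⟨(T[k]).kind, (T[k]).args.map (remap w off)⟩)
    (inp : ℕ → Bool) {k : ℕ} (hk : k < T.length) :
    wireVal t inp (off + k) = wireVal T (fun i => refVal inp (wireVal t inp) (w i)) k := by
  induction k using Nat.strong_induction_on with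
  | _ k ih =>
    obtain ⟨hk', heq⟩ := ht k hk
    rw [wireVal_eq hwf inp hk', wireVal_eq hwfT _ hk, heq]
    have harg : ∀ i, argVal inp (wireVal t inp) ((T[k]).args.map (remap w off)) i =
        argVal (fun i => refVal inp (wireVal t inp) (w i)) (wireVal T fun i => refVal inp (wireVal t inp) (w i)) (T[k]).args i := by
      intro i
      rw [argVal_map_remap]
      unfold argVal
      cases ha : (T[k]).args[i]? with
      | none => rfl
      | some a =>
        cases a with
        | inl i' => rfl
        | inr j =>
          have hj : j < k := ((hwfT k hk).2 _ (List.mem_of_getElem? ha)).2 j rfl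
          simp only [refVal]
          exact ih j hj (by omega)
    simp only [harg]

/-- **Wire values only depend on the inputs the template reads** (inputs below `nIn` for a
template well formed with `nIn` inputs). [cite: Vollmer1999, Def. 1.7] -/
theorem wireVal_congr {t : Template} {nIn : ℕ} (hwf : t.WF nIn) {f g : ℕ → Bool} (hfg : ∀ i < nIn, f i = g i) {k : ℕ} (hk : k < t.length) :
    wireVal t f k = wireVal t g k := by
  induction k using Nat.strong_induction_on with
  | _ k ih =>
    rw [wireVal_eq hwf f hk, wireVal_eq hwf g hk]
    have harg : ∀ i, argVal f (wireVal t f) (t[k]).args i = argVal g (wireVal t g) (t[k]).args i := by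
      intro i
      unfold argVal
      cases ha : (t[k]).args[i]? with
      | none => rfl
      | some a =>
        obtain ⟨h₁, h₂⟩ := (hwf k hk).2 a (List.mem_of_getElem? ha)
        cases a with
        | inl i' => exact hfg i' (h₁ i' rfl)
        | inr j => exact ih j (h₂ j rfl) (by have := h₂ j rfl; omega)
    simp only [harg]

/-- Wire values beyond the template are `false`. [folklore] -/
theorem wireVal_of_le {t : Template} (inp : ℕ → Bool) {k : ℕ} (hk : t.length ≤ k) : wireVal t inp k = false := by
  rw [wireVal]; simp [List.getElem?_eq_none hk]

/-- **Wire values of a layout**: the gates of piece `k` carry the wire values of its template on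
the values it reads. [cite: Vollmer1999, Def. 1.7] -/
theorem wireVal_layout (P : ℕ → Piece) {N nIn : ℕ} (hok : ∀ k < N, Piece.OK P nIn k) (inp : ℕ → Bool) {k : ℕ} (hk : k < N) {j : ℕ}
    (hj : j < (P k).T.length) :
    wireVal (layout P N) inp (offset P k + j) = wireVal (P k).T (fun i => refVal inp (wireVal (layout P N) inp) ((P k).wire i)) j :=
  wireVal_embed (wf_layout P hok) (hok k hk).1 (fun _ hj' => getElem_layout P hk hj') inp hj

/-! ### Words -/

/-- The number carried by the low `W` bits of a word of Booleans. [folklore] -/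
def wval (f : ℕ → Bool) : ℕ → ℕ
  | 0 => 0
  | W + 1 => wval f W + (f W).toNat * 2 ^ W

/-- Unfolding. [folklore] -/
@[simp] theorem wval_zero (f : ℕ → Bool) : wval f 0 = 0 := rfl

/-- Unfolding. [folklore] -/
theorem wval_succ (f : ℕ → Bool) (W : ℕ) : wval f (W + 1) = wval f W + (f W).toNat * 2 ^ W := rfl

/-- `toNat` of a Boolean is at most one. [folklore] -/
theorem toNat_le_one (b : Bool) : b.toNat ≤ 1 := by cases b <;> simp

/-- A `W`-bit word carries a number `< 2^W`. [folklore] -/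
theorem wval_lt (f : ℕ → Bool) : ∀ W, wval f W < 2 ^ W
  | 0 => Nat.one_pos
  | W + 1 => by
    rw [wval_succ, Nat.pow_succ]
    have := wval_lt f W
    have := toNat_le_one (f W)
    nlinarith

/-- Words agreeing below `W` carry the same number. [folklore] -/
theorem wval_congr {f g : ℕ → Bool} : ∀ {W : ℕ}, (∀ i < W, f i = g i) → wval f W = wval g W
  | 0, _ => rfl
  | W + 1, h => by rw [wval_succ, wval_succ, wval_congr fun i hi => h i (by omega), h W (by omega)]

/-- Uniqueness of division with remainder. [folklore] -/
theorem eq_of_add_mul_eq {a b a' b' m : ℕ} (h : a + b * m = a' + b' * m) (ha : a < m) (ha' : a' < m) : a = a' ∧ b = b' := by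
  have hm : 0 < m := by omega
  have h1 : (a + b * m) % m = (a' + b' * m) % m := by rw [h]
  rw [Nat.add_mul_mod_self_right, Nat.add_mul_mod_self_right, Nat.mod_eq_of_lt ha, Nat.mod_eq_of_lt ha'] at h1
  subst h1
  refine ⟨rfl, ?_⟩
  have h2 : b * m = b' * m := by omega
  exact Nat.eq_of_mul_eq_mul_right hm h2

/-- **Words carrying the same number agree.** [folklore] -/
theorem wval_inj {f g : ℕ → Bool} : ∀ {W : ℕ}, wval f W = wval g W → ∀ i < W, f i = g i
  | 0, _, i, hi => absurd hi (Nat.not_lt_zero i)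
  | W + 1, h, i, hi => by
    rw [wval_succ, wval_succ] at h
    obtain ⟨h1, h2⟩ := eq_of_add_mul_eq h (wval_lt f W) (wval_lt g W)
    rcases Nat.lt_succ_iff_lt_or_eq.1 hi with hi' | rfl
    · exact wval_inj h1 i hi'
    · revert h2; cases f i <;> cases g i <;> simp

/-- The parity of the number carried by a word is its bit `0`. [folklore] -/
theorem wval_mod_two (f : ℕ → Bool) : ∀ {W : ℕ}, 0 < W → wval f W % 2 = (f 0).toNat
  | 0, h => absurd h (lt_irrefl 0)
  | W + 1, _ => by
    rw [wval_succ]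
    rcases Nat.eq_zero_or_pos W with rfl | hW
    · cases f 0 <;> simp
    · rw [show 2 ^ W = 2 * 2 ^ (W - 1) by rw [← Nat.pow_succ']; congr 1; omega, ← Nat.mul_assoc, Nat.mul_comm _ 2, Nat.mul_assoc,
        Nat.add_mul_mod_self_left, wval_mod_two f hW]

/-- **Reading the bits of a number**: the word of the bits of `n` carries `n mod 2^W`.
[folklore] -/
theorem wval_testBit (n : ℕ) : ∀ W, wval (fun i => n.testBit i) W = n % 2 ^ W
  | 0 => by simp [Nat.mod_one]
  | W + 1 => by rw [wval_succ, wval_testBit n W, Nat.mod_pow_succ, Nat.toNat_testBit, Nat.mul_comm]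

/-- A number `< 2^W` is carried by the word of its bits. [folklore] -/
theorem wval_testBit_of_lt {n W : ℕ} (h : n < 2 ^ W) : wval (fun i => n.testBit i) W = n := by rw [wval_testBit, Nat.mod_eq_of_lt h]

/-- A word with all bits false carries `0`. [folklore] -/
theorem wval_eq_zero {f : ℕ → Bool} : ∀ {W : ℕ}, (∀ i < W, f i = false) → wval f W = 0
  | 0, _ => rfl
  | W + 1, h => by rw [wval_succ, wval_eq_zero fun i hi => h i (by omega), h W (by omega)]; simp

/-- The one-hot word `(1, 0, …, 0)` carries `1` (for `W > 0`). [folklore] -/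
theorem wval_onehot {f : ℕ → Bool} : ∀ {W : ℕ}, 0 < W → (∀ i < W, f i = decide (i = 0)) → wval f W = 1
  | 0, h, _ => absurd h (lt_irrefl 0)
  | W + 1, _, h => by
    rcases Nat.eq_zero_or_pos W with rfl | hW
    · rw [wval_succ, wval_zero, h 0 Nat.one_pos]; simp
    · rw [wval_succ, wval_onehot hW fun i hi => h i (by omega), h W (by omega)]; simp; omega

end Netlist

open Netlist

/-! ### The adder adds -/

namespace Adder

/-- The full adder: `a + b + c = s + 2 c'` with `s = a ⊕ b ⊕ c`, `c' = maj(a, b, c)`. [folklore] -/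
theorem fullAdder (a b c : Bool) :
    a.toNat + b.toNat + c.toNat = ((a ^^ b) ^^ c).toNat + 2 * ((a && b) || (c && (a || b))).toNat := by
  cases a <;> cases b <;> cases c <;> rfl

/-- Wire `0` of the adder is the carry-in. [folklore] -/
theorem wireVal_cin (c₀ : Bool) (W : ℕ) (inp : ℕ → Bool) : wireVal (addT c₀ W) inp 0 = c₀ := by
  rw [wireVal_eq (wf_addT c₀ W) inp (by simp), addT_zero]; rfl

/-- The sum gate evaluates `xᵢ ⊕ yᵢ ⊕ cᵢ`. [folklore] -/
theorem wireVal_sum (c₀ : Bool) (W : ℕ) (inp : ℕ → Bool) {i : ℕ} (hi : i < W) :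
    wireVal (addT c₀ W) inp (2 * i + 1) = ((inp i ^^ inp (W + i)) ^^ wireVal (addT c₀ W) inp (2 * i)) := by
  rw [wireVal_eq (wf_addT c₀ W) inp (by simp; omega), addT_sum c₀ W hi]; rfl

/-- The carry gate evaluates `maj(xᵢ, yᵢ, cᵢ)`. [folklore] -/
theorem wireVal_carry (c₀ : Bool) (W : ℕ) (inp : ℕ → Bool) {i : ℕ} (hi : i < W) :
    wireVal (addT c₀ W) inp (2 * i + 2) =
      ((inp i && inp (W + i)) || (wireVal (addT c₀ W) inp (2 * i) && (inp i || inp (W + i)))) := by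
  rw [wireVal_eq (wf_addT c₀ W) inp (by simp; omega), addT_carry c₀ W hi]; rfl

/-- **The ripple-carry adder adds** (the invariant at every position): the sum bits below `k`
and the carry `c_k` carry `x mod 2^k + y mod 2^k + c₀`. [cite: Vollmer1999, §1.1] -/
theorem wireVal_addT (c₀ : Bool) (W : ℕ) (inp : ℕ → Bool) : ∀ {k : ℕ}, k ≤ W →
    wval (fun i => wireVal (addT c₀ W) inp (2 * i + 1)) k + (wireVal (addT c₀ W) inp (2 * k)).toNat * 2 ^ k =
      wval (fun i => inp i) k + wval (fun i => inp (W + i)) k + c₀.toNat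
  | 0, _ => by simp [wireVal_cin]
  | k + 1, hk => by
    have ih := wireVal_addT c₀ W inp (k := k) (by omega)
    have hf := fullAdder (inp k) (inp (W + k)) (wireVal (addT c₀ W) inp (2 * k))
    rw [wval_succ, wval_succ, wval_succ, show 2 * (k + 1) = 2 * k + 2 by ring, wireVal_carry c₀ W inp (by omega), wireVal_sum c₀ W inp (by omega),
      Nat.pow_succ]
    have h2 := congrArg (· * 2 ^ k) hf
    simp only [Nat.add_mul] at h2
    ring_nf at h2 ih ⊢
    linarith

/-- **The value of the sum**: the `W` sum bits and the carry-out carry `x + y + c₀`.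
[cite: Vollmer1999, §1.1] -/
theorem wval_sum_addT (c₀ : Bool) (W : ℕ) (inp : ℕ → Bool) :
    wval (fun i => wireVal (addT c₀ W) inp (2 * i + 1)) W + (wireVal (addT c₀ W) inp (2 * W)).toNat * 2 ^ W =
      wval (fun i => inp i) W + wval (fun i => inp (W + i)) W + c₀.toNat :=
  wireVal_addT c₀ W inp le_rfl

end Adder

/-! ### The comparator compares -/

namespace Sub

/-- The complement gates evaluate `¬yⱼ`. [folklore] -/
theorem wireVal_not (w : ℕ) (inp : ℕ → Bool) {j : ℕ} (hj : j < w) : wireVal (subT w) inp j = !inp (w + j) := by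
  rw [wireVal_eq (wf_subT w) inp (by simp; omega), subT_not w hj]; rfl

/-- The embedded adder of the comparator adds `x` and `¬y` with carry-in `1`. [folklore] -/
theorem wireVal_subT_adder (w : ℕ) (inp : ℕ → Bool) {k : ℕ} (hk : k < (Adder.addT true w).length) :
    wireVal (subT w) inp (w + k) = wireVal (Adder.addT true w) (fun i => if i < w then inp i else !inp i) k := by
  rw [wireVal_embed (wf_subT w) (Adder.wf_addT true w) (fun k hk => subT_emb w hk) inp hk]
  refine wireVal_congr (Adder.wf_addT true w) (fun i hi => ?_) hk
  unfold wiring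
  split_ifs with h
  · rfl
  · simp only [refVal]
    rw [wireVal_not w inp (by omega), show w + (i - w) = i by omega]

/-- The complement word carries `2^w - 1 - y`. [folklore] -/
theorem wval_not (f : ℕ → Bool) : ∀ w, wval (fun i => !f i) w + wval f w = 2 ^ w - 1
  | 0 => rfl
  | w + 1 => by
    rw [wval_succ, wval_succ, Nat.pow_succ]
    have ih := wval_not f w
    have h1 : 1 ≤ 2 ^ w := Nat.one_le_two_pow
    cases f w <;> simp <;> omega

/-- The core of the comparator: the sum bits `S` and the carry-out `c` of `x + ¬y + 1` satisfy
`S + c · 2^w = x + (2^w - 1 - y) + 1`. [cite: Vollmer1999, §1.1] -/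
theorem subT_core (w : ℕ) (inp : ℕ → Bool) :
    wval (fun i => wireVal (subT w) inp (w + (2 * i + 1))) w + (wireVal (subT w) inp (3 * w)).toNat * 2 ^ w + wval (fun i => inp (w + i)) w =
      wval (fun i => inp i) w + 2 ^ w := by
  set f : ℕ → Bool := fun i => if i < w then inp i else !inp i with hf
  have hA := Adder.wval_sum_addT true w f
  have hS : wval (fun i => wireVal (subT w) inp (w + (2 * i + 1))) w = wval (fun i => wireVal (Adder.addT true w) f (2 * i + 1)) w :=
    wval_congr fun i hi => wireVal_subT_adder w inp (by simp; omega)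
  have hC : wireVal (subT w) inp (3 * w) = wireVal (Adder.addT true w) f (2 * w) := by
    rw [show 3 * w = w + 2 * w by ring]; exact wireVal_subT_adder w inp (by simp)
  have hX : wval (fun i => f i) w = wval (fun i => inp i) w := wval_congr fun i hi => by simp [hf, hi]
  have hNY : wval (fun i => f (w + i)) w = wval (fun i => !inp (w + i)) w := wval_congr fun i hi => by simp [hf]
  have hc := wval_not (fun i => inp (w + i)) w
  have h1 : 1 ≤ 2 ^ w := Nat.one_le_two_pow
  rw [hS, hC]
  rw [hX, hNY] at hA
  rcases Bool.eq_false_or_eq_true (wireVal (Adder.addT true w) f (2 * w)) with hct | hct <;> rw [hct] at hA ⊢ <;>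
    simp only [Bool.toNat_true, Bool.toNat_false, Nat.one_mul, Nat.zero_mul, Nat.add_zero] at hA ⊢ <;> omega

/-- **The comparator compares**: the carry-out `ge w` of `x + ¬y + 1` is `[x ≥ y]`, for the
numbers `x`, `y` carried by the operands. [cite: Vollmer1999, §1.1] -/
theorem wireVal_subT_ge (w : ℕ) (inp : ℕ → Bool) :
    wireVal (subT w) inp (3 * w) = decide (wval (fun i => inp (w + i)) w ≤ wval (fun i => inp i) w) := by
  have h := subT_core w inp
  have hslt := wval_lt (fun i => wireVal (subT w) inp (w + (2 * i + 1))) w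
  have hylt := wval_lt (fun i => inp (w + i)) w
  cases hcc : wireVal (subT w) inp (3 * w)
  · rw [hcc] at h; simp at h; symm; rw [decide_eq_false_iff_not]; omega
  · rw [hcc] at h; simp at h; symm; rw [decide_eq_true_iff]; omega

/-- **The difference bits**: when `x ≥ y` the sum bits of `x + ¬y + 1` carry `x - y`.
[cite: Vollmer1999, §1.1] -/
theorem wval_subT_d (w : ℕ) (inp : ℕ → Bool) (hge : wval (fun i => inp (w + i)) w ≤ wval (fun i => inp i) w) :
    wval (fun i => wireVal (subT w) inp (w + (2 * i + 1))) w = wval (fun i => inp i) w - wval (fun i => inp (w + i)) w := by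
  have h := subT_core w inp
  rw [wireVal_subT_ge w inp, decide_eq_true hge] at h
  simp at h
  omega

end Sub

end Literature.Computability.MetaComplexity
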